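/-
Copyright: cell `pub-ymgap` (HUMAN RULING D-0062), Track A of `YM-PLAN.md`, DAG node N20 (= NE7b); R134 seat `pub-ymgap-dag-n20-d`
(strategy s3 «alternative currency», generation 5), module 5.  Released under the licence of the surrounding project.
-/
import Summits.QuantumFields.YangMills.Theorems.BalabanUVNodesN20ByValueExtraction

/-!
# YM-DAG node N20 (= NE7b), strategy s3, THE FOURTH CURRENCY «BY VALUE» (module 5): THE ROAD's KEYED EXTRACTION LAWS FROM ONE JOINT-SPARSENESS
# INEQUALITY PER (CUTOFF, KEY) — the by-value twin of gaps-ne6's `LocalConditionalStability.extractionLaws_of_LCS_of_subset` ∕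
# `PrefixExtractionLaws.extractionLaws_of_prefix_of_subset`: on a cutoff family of MODULE towers the re-cut (α) road's display structure
# `PinnedExtraction.ExtractionLaws` (the END record's `extractA`) follows from the decomposition of unity, pinned-sum letters and the inequalities (JS),
# with NO per-step display `hrel`, NO conditional moment, NO telescoping ∕ integrability displays beyond «good ⇒ integrable»

Track A of `YM-PLAN.md` (cell `pub-ymgap`, HUMAN RULING D-0062), node **N20** = spine estimate NE7b (`T4WeightBudget.RelWeightBound` — the cell
`pub-balaban`'s OWN estimate, NOT PRINTED in [Bałaban 1983–89], NOT PROVED).  Seat `pub-ymgap-dag-n20-d` (R134, s3), generation 5, module 5 after modules 1–4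
(`…N20ByValueTelescoping` p496513, `…N20ByValueExtraction` p497227, `…N20ByValueAtRecord` p498565, `…N20ByValueKernelSteps`).  Kernel theorems only: 0 `def`,
0 `sorry`, standard axioms; COUNT-NEUTRAL (`--supports` K3‴ `SpineGivenEndpointR13`, stmt-QuantumFields-19912, `--as helper`).  Restate-immune.

THE POINT.  The re-cut (α) road (owner rulings W-ne7bp1-g103-1∕-2) carries NE7b's numerator as the KEYED display structure `PinnedExtraction.ExtractionLaws`
over the cutoff family of towers `T K` with skeletons `skelFam T p₀`, M2-A weights `Repr172R.weight … (reprFam T p₀ ρ₀ hρ h0 B hB) t`, bad classes `Bad K t`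
covered by keyed sub-classes `Badx K x ⊆ badx T p₀ S K x` (READ INTO pattern classes; `KeyPatternReading.fibre_kmemA_subset_badx` discharges the reading for the
keys of record).  gaps-ne6 derives it from PER-STEP relative displays `hrel` (`extractionLaws_of_prefix_of_subset`), i.e. from POINTWISE EXTRACTION + «LCS-j»
(`extractionLaws_of_LCS_of_subset`).  THIS MODULE derives THE SAME STRUCTURE on a family of MODULE towers (module 1's `hmod` per cutoff) from:
the decomposition of unity `hunit`, pinned-sum letters `e K x j` along each key's pattern (`hpin`), «good ⇒ integrable» at every level (`hGdInt`, the model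
class `bddMeas` under finite measures), and ONE inequality per (cutoff, source value, key)
  (JS) `∫ (Π_{j<K} e K x j (iterMap (avg K) j y))·ρ₀ K t y dν_{K,0} ≤ q K x · ∫ ρ₀ K t dν_{K,0}`
— so the road's END may be fed, key by key, EITHER by «LCS-j» (conditional, per step) OR by (JS) (joint, unconditional, at level 0).
* §1 `hpres_of_hmod` (termwise integral preservation FROM `hmod` + `hunit` — the telescoping display gaps-ne6 asks is a CONSEQUENCE on a module tower);
  `sum_termSet_weight_eq_integral_byValue` (the full cutoff-`K` sum of M2-A weights IS `∫ ρ₀ K t dν_{K,0}`, all four displays of gaps-ne6's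
  `sum_termSet_weight_eq_integral` discharged from `hmod` ∕ `hunit` ∕ `hGdInt`).
* §2 ★ `extract_byValue_of_subset` (ONE cutoff, source value, key: `Σ_{Badx'} weight ≤ q·Σ_{termSet} weight` from (JS)); ★★ `extractionLaws_byValue_of_subset`
  (THE KEYED `ExtractionLaws` with quotients `q K x`); `extractionLaws_byValue_of_jointMoment` (Chebyshev letters at the pinned levels `J K x`: quotients
  `exp Σ_{j ∈ J K x, j<K} (b K x j − δ K x j·θ K x j)` from the joint multiscale exponential moments (JM) — the by-value cost–volume bookkeeping, ready for
  the cell's count `Σ_x q K x ≤ W K`, `T4WeightBudget.relWeight_le_sum_of_cover` ∕ `PinnedExtraction.relWeightBound_of_extraction`).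

HONEST FRAMING.  Count-neutral kernel bookkeeping [folklore] over gaps-ne6's skeleton ∕ weights ∕ pattern classes BY NAME; which towers are Bałaban's and
whether they are module towers is (A1c) DATA (NC-NE7b-α UNRULED); (JS)∕(JM) for several pinned levels are HYPOTHESES (binders), NOT in the tree, NOT printed
as statements; the cover ∕ reading ∕ count are the road's other binders, untouched; nothing of Bałaban's asserted, valued or instantiated; NE7b NOT PRINTED ∕
NOT PROVED; the (α)-instance 0∕1; N20 NOT discharged (typed 28∕28, discharged count untouched); one finite four-torus programme at fixed `ε` — NOT ℝ⁴, NOT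
infinite volume, NOT OS, NOT a mass gap, NOT Clay.  References (LOCATORS only; no decl carries a cite tag): T. Bałaban, CMP **122** (1989) 355–392
[Balaban1989LargeFieldII] ((1.71)∕(1.72) p. 378–379, (1.79) p. 383).
-/

set_option autoImplicit false

noncomputable section

open Finset MeasureTheory
open Summit.QuantumFields.BalabanUV.T4Continuum.B16HistoryIndexedRepr
open Summit.QuantumFields.BalabanUV.T4Continuum.B16HistoryReprChain
open Summit.QuantumFields.BalabanUV.T4Continuum.B16HistoryReprInstance
open Summit.QuantumFields.BalabanUV.T4Continuum.NE7b.PinnedExtraction (ExtractionLaws)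
open Summit.QuantumFields.BalabanUV.T4Continuum.NE7b.PrefixExtraction (admS admS_subset_adm)
open Summit.QuantumFields.BalabanUV.T4Continuum.NE7b.PrefixExtractionLaws (badx sum_badx_weight sum_termSet_weight_eq_integral weight_reprFam_nonneg)
open Summit.QuantumFields.BalabanUV.T4Continuum.NE7b.LocalConditionalStability (chebyshev_extraction)
open Summit.QuantumFields.BalabanUV.T4Continuum.ShellMeasureAverageIterate (iterMap)
open Summit.QuantumFields.YangMills.BalabanUVNodes.N20ByValueTelescoping
open Summit.QuantumFields.YangMills.BalabanUVNodes.N20ByValueExtraction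

namespace Summit.QuantumFields.YangMills.BalabanUVNodes.N20ByValueLaws

/-! ## §1 On a module tower the telescoping displays are consequences -/

section OneTower

variable {P : Type} [DecidableEq P] {C : ℕ → Type} {𝒢 : (j : ℕ) → GoodClass (C j)}
  (T : Tower P C 𝒢) [∀ j, MeasurableSpace (C j)] (μ : (j : ℕ) → Measure (C j))
  (avg : (j : ℕ) → C j → C (j + 1)) (χ : (j : ℕ) → (Fin j → P) → P → C j → ℝ)

omit [DecidableEq P] in
/-- **TERMWISE INTEGRAL PRESERVATION FROM THE MODULE PROPERTY**: `hmod` at `m = 1`, the decomposition of unity and «good ⇒ integrable» give gaps-ne6's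
telescoping display `hpres : ∫ Σ_{p ∈ branch j g} (op j g p)(eterm j g) dμ_{j+1} = ∫ eterm j g dμ_j` after every admissible history. [folklore] -/
theorem hpres_of_hmod (hχ : ∀ j g p, (𝒢 j).Gd (χ j g p))
    (hmod : ∀ (j : ℕ) (g : Fin j → P) (p : P), g ∈ T.adm j → p ∈ T.branch j g → ∀ (m : C (j + 1) → ℝ) (f : C j → ℝ),
      (𝒢 (j + 1)).Gd m → (𝒢 j).Gd f →
        ∫ x, m x * (T.op j g p).T f x ∂μ (j + 1) = ∫ y, m (avg j y) * (χ j g p y * f y) ∂μ j)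
    (hunit : ∀ (j : ℕ) (g : Fin j → P), g ∈ T.adm j → ∀ y, ∑ p ∈ T.branch j g, χ j g p y = 1)
    (hGdInt : ∀ (j : ℕ) (f : C j → ℝ), (𝒢 j).Gd f → Integrable f (μ j))
    {ρ₀ : C 0 → ℝ} (hρ : (𝒢 0).Gd ρ₀) (j : ℕ) (g : Fin j → P) (hg : g ∈ T.adm j) :
    ∫ x, (∑ p ∈ T.branch j g, (T.op j g p).T (T.eterm ρ₀ j g) x) ∂μ (j + 1) = ∫ y, T.eterm ρ₀ j g y ∂μ j := by
  have hgood : (𝒢 j).Gd (T.eterm ρ₀ j g) := T.eterm_good hρ j g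
  rw [integral_finsetSum _ fun p _ => hGdInt (j + 1) _ ((T.op j g p).map_good hgood)]
  have e : ∀ p ∈ T.branch j g, ∫ x, (T.op j g p).T (T.eterm ρ₀ j g) x ∂μ (j + 1) = ∫ y, χ j g p y * T.eterm ρ₀ j g y ∂μ j :=
    fun p hp => by
      have h := hmod j g p hg hp (fun _ => 1) _ ((𝒢 (j + 1)).const 1) hgood
      simpa only [one_mul] using h
  rw [Finset.sum_congr rfl e, ← integral_finsetSum _ fun p _ => hGdInt j _ ((𝒢 j).mul (hχ j g p) hgood)]
  refine integral_congr_ae (Filter.Eventually.of_forall fun y => ?_)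
  show ∑ p ∈ T.branch j g, χ j g p y * T.eterm ρ₀ j g y = T.eterm ρ₀ j g y
  rw [← Finset.sum_mul, hunit j g hg y, one_mul]

end OneTower

/-! ## §2 The road's keyed extraction laws from ONE joint-sparseness inequality per (cutoff, key) -/

section Laws

variable {P : Type} [DecidableEq P] {C : ℕ → ℕ → Type} {𝒢 : (K j : ℕ) → GoodClass (C K j)}
  (T : (K : ℕ) → Tower P (C K) (𝒢 K)) (p₀ : ℕ → ℕ → P)
  (ρ₀ : (K : ℕ) → ℝ → C K 0 → ℝ) (hρ : ∀ K t, (𝒢 K 0).Gd (ρ₀ K t)) (h0 : ∀ K t x, 0 ≤ ρ₀ K t x)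
  (B : ℕ → ℝ → ℝ) (hB : ∀ K t, 0 < B K t) [∀ K j, MeasurableSpace (C K j)] (ν : (K j : ℕ) → Measure (C K j))
  (avg : (K j : ℕ) → C K j → C K (j + 1)) (χ : (K j : ℕ) → (Fin j → P) → P → C K j → ℝ)

/-- **THE FULL CUTOFF-`K` SUM OF WEIGHTS IS `∫ ρ₀ K t dν_{K,0}`, BY VALUE**: gaps-ne6's `sum_termSet_weight_eq_integral` with its four displays (`hint`,
`hint'`, `hpres`, `hintM`) discharged on a module tower from `hmod`, `hunit` and «good ⇒ integrable» at every level of the cutoff-`K` tower. [folklore] -/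
theorem sum_termSet_weight_eq_integral_byValue (hp₀ : ∀ K j g, p₀ K j ∈ (T K).branch j g) (K : ℕ) (t : ℝ)
    (hχ : ∀ j g p, (𝒢 K j).Gd (χ K j g p))
    (hmod : ∀ (j : ℕ) (g : Fin j → P) (p : P), g ∈ (T K).adm j → p ∈ (T K).branch j g → ∀ (m : C K (j + 1) → ℝ) (f : C K j → ℝ),
      (𝒢 K (j + 1)).Gd m → (𝒢 K j).Gd f →
        ∫ x, m x * ((T K).op j g p).T f x ∂ν K (j + 1) = ∫ y, m (avg K j y) * (χ K j g p y * f y) ∂ν K j)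
    (hunit : ∀ (j : ℕ) (g : Fin j → P), g ∈ (T K).adm j → ∀ y, ∑ p ∈ (T K).branch j g, χ K j g p y = 1)
    (hGdInt : ∀ (j : ℕ) (f : C K j → ℝ), (𝒢 K j).Gd f → Integrable f (ν K j)) :
    ∑ τ ∈ HIndex.termSet (skelFam T p₀) K,
        Repr172R.weight (I := skelFam T p₀) (fun K => ν K K) (reprFam T p₀ ρ₀ hρ h0 B hB) t τ =
      ∫ U, ρ₀ K t U ∂ν K 0 :=
  sum_termSet_weight_eq_integral T p₀ ρ₀ hρ h0 B hB ν hp₀ K t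
    (fun j g _ _ => hGdInt j _ ((T K).eterm_good (hρ K t) j g))
    (fun j g p _ _ _ => hGdInt (j + 1) _ (((T K).op j g p).map_good ((T K).eterm_good (hρ K t) j g)))
    (fun j g _ hg => hpres_of_hmod (T K) (ν K) (avg K) (χ K) hχ hmod hunit hGdInt (hρ K t) j g hg)
    (fun a ι _ => hGdInt K _ ((𝒢 K K).mul ((reprFam T p₀ ρ₀ hρ h0 B hB K t).χ_good a)
      (((reprFam T p₀ ρ₀ hρ h0 B hB K t).TZh a ι.1).map_good ((reprFam T p₀ ρ₀ hρ h0 B hB K t).innerH_good a ι))))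

variable {α : Type*} (S : (K : ℕ) → α → (j : ℕ) → (Fin j → P) → Finset P) (e : (K : ℕ) → α → (j : ℕ) → C K j → ℝ)

/-- **THE DISPLAY `extract` FOR ONE CUTOFF, SOURCE VALUE AND KEY, BY VALUE.**  For a sub-class `Badx' ⊆ badx T p₀ S K x` read into the pattern class of the
key's pattern `S K x` on the MODULE tower `T K` (`hmod`, `hunit`, «good ⇒ integrable», `havg`), non-negative good characteristic functions and pinned-sum letters
`Σ_{branch ∩ S K x} χ_{K,j,g,·} ≤ e K x j` at the pattern prefixes below `K`, the ONE inequality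
  (JS) `∫ (Π_{j<K} e K x j (iterMap (avg K) j y))·ρ₀ K t y dν_{K,0} ≤ q·∫ ρ₀ K t dν_{K,0}`
gives `Σ_{τ ∈ Badx'} A t τ ≤ q · Σ_{τ ∈ termSet K} A t τ` for M2-A's weights — `PrefixExtractionLaws.extract_of_prefix_of_subset` with `hrel` ∕ `hint` ∕
`hint'` ∕ `hpres` ∕ `hintM` replaced by (JS) and the module data. [folklore] -/
theorem extract_byValue_of_subset (hp₀ : ∀ K j g, p₀ K j ∈ (T K).branch j g) (K : ℕ) (t : ℝ) (x : α)
    {Badx' : Finset (HIndex.Idx (skelFam T p₀))} (hsub : Badx' ⊆ badx T p₀ S K x)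
    (havg : ∀ (j : ℕ) (m : C K (j + 1) → ℝ), (𝒢 K (j + 1)).Gd m → (𝒢 K j).Gd (fun y => m (avg K j y)))
    (hχ : ∀ j g p, (𝒢 K j).Gd (χ K j g p)) (hχ0 : ∀ j g p y, 0 ≤ χ K j g p y)
    (hmod : ∀ (j : ℕ) (g : Fin j → P) (p : P), g ∈ (T K).adm j → p ∈ (T K).branch j g → ∀ (m : C K (j + 1) → ℝ) (f : C K j → ℝ),
      (𝒢 K (j + 1)).Gd m → (𝒢 K j).Gd f →
        ∫ x, m x * ((T K).op j g p).T f x ∂ν K (j + 1) = ∫ y, m (avg K j y) * (χ K j g p y * f y) ∂ν K j)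
    (hunit : ∀ (j : ℕ) (g : Fin j → P), g ∈ (T K).adm j → ∀ y, ∑ p ∈ (T K).branch j g, χ K j g p y = 1)
    (hGdInt : ∀ (j : ℕ) (f : C K j → ℝ), (𝒢 K j).Gd f → Integrable f (ν K j))
    (he : ∀ j y, 0 ≤ e K x j y) (heg : ∀ j, (𝒢 K j).Gd (e K x j))
    (hpin : ∀ (j : ℕ) (g : Fin j → P), j < K → g ∈ admS (T K) (S K x) j → ∀ y, ∑ p ∈ (T K).branch j g ∩ S K x j g, χ K j g p y ≤ e K x j y)
    {q : ℝ} (hJS : ∫ y, (∏ j ∈ Finset.range K, e K x j (iterMap (E := fun j => C K j) (avg K) j y)) * ρ₀ K t y ∂ν K 0 ≤ q * ∫ y, ρ₀ K t y ∂ν K 0) :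
    ∑ τ ∈ Badx', Repr172R.weight (I := skelFam T p₀) (fun K => ν K K) (reprFam T p₀ ρ₀ hρ h0 B hB) t τ ≤
      q * ∑ τ ∈ HIndex.termSet (skelFam T p₀) K, Repr172R.weight (I := skelFam T p₀) (fun K => ν K K) (reprFam T p₀ ρ₀ hρ h0 B hB) t τ := by
  refine (Finset.sum_le_sum_of_subset_of_nonneg hsub fun τ _ _ => weight_reprFam_nonneg T p₀ ρ₀ hρ h0 B hB ν t τ).trans ?_
  rw [sum_badx_weight, sum_termSet_weight_eq_integral_byValue T p₀ ρ₀ hρ h0 B hB ν avg χ hp₀ K t hχ hmod hunit hGdInt]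
  exact (sum_admS_integral_le_integral_prod (T K) (ν K) (avg K) (χ K) (S K x) (e K x) havg hχ hχ0 hmod (hρ K t) (h0 K t)
    (hGdInt 0) he heg K hpin).trans hJS

/-- **THE ROAD's KEYED EXTRACTION LAWS, BY VALUE.**  For the cutoff family of MODULE towers of the re-cut road's records: keyed sub-classes `Badx K x` covering
the bad class on the source window and READ INTO pattern classes (`hread`), the module data per cutoff (`havg`, `hχ`, `hχ0`, `hmod`, `hunit`, «good ⇒
integrable»), pinned-sum letters per (cutoff, key, level) and ONE inequality (JS) per (cutoff, source value, key) with non-negative quotients `q K x` give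
`PinnedExtraction.ExtractionLaws` for run A's weights with quotients `q` — the by-value twin of `extractionLaws_of_prefix_of_subset` ∕
`LocalConditionalStability.extractionLaws_of_LCS_of_subset` (no `hrel`, no `LocCondStability`, no telescoping display). [folklore] -/
theorem extractionLaws_byValue_of_subset {l₀ : ℝ} (Bad : ℕ → ℝ → Finset (HIndex.Idx (skelFam T p₀)))
    (X : ℕ → Finset α) (Badx : ℕ → α → Finset (HIndex.Idx (skelFam T p₀))) (q : ℕ → α → ℝ)
    (hp₀ : ∀ K j g, p₀ K j ∈ (T K).branch j g)
    (bad_subset : ∀ K t, |t| ≤ l₀ → Bad K t ⊆ HIndex.termSet (skelFam T p₀) K)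
    (cover : ∀ K t, |t| ≤ l₀ → ∀ τ ∈ Bad K t, ∃ x ∈ X K, τ ∈ Badx K x)
    (hread : ∀ K, ∀ x ∈ X K, Badx K x ⊆ badx T p₀ S K x)
    (havg : ∀ (K j : ℕ) (m : C K (j + 1) → ℝ), (𝒢 K (j + 1)).Gd m → (𝒢 K j).Gd (fun y => m (avg K j y)))
    (hχ : ∀ K j g p, (𝒢 K j).Gd (χ K j g p)) (hχ0 : ∀ K j g p y, 0 ≤ χ K j g p y)
    (hmod : ∀ (K j : ℕ) (g : Fin j → P) (p : P), g ∈ (T K).adm j → p ∈ (T K).branch j g → ∀ (m : C K (j + 1) → ℝ) (f : C K j → ℝ),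
      (𝒢 K (j + 1)).Gd m → (𝒢 K j).Gd f →
        ∫ x, m x * ((T K).op j g p).T f x ∂ν K (j + 1) = ∫ y, m (avg K j y) * (χ K j g p y * f y) ∂ν K j)
    (hunit : ∀ (K j : ℕ) (g : Fin j → P), g ∈ (T K).adm j → ∀ y, ∑ p ∈ (T K).branch j g, χ K j g p y = 1)
    (hGdInt : ∀ (K j : ℕ) (f : C K j → ℝ), (𝒢 K j).Gd f → Integrable f (ν K j))
    (he : ∀ K, ∀ x ∈ X K, ∀ j y, 0 ≤ e K x j y) (heg : ∀ K, ∀ x ∈ X K, ∀ j, (𝒢 K j).Gd (e K x j))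
    (hpin : ∀ K, ∀ x ∈ X K, ∀ (j : ℕ) (g : Fin j → P), j < K → g ∈ admS (T K) (S K x) j →
      ∀ y, ∑ p ∈ (T K).branch j g ∩ S K x j g, χ K j g p y ≤ e K x j y)
    (hq : ∀ K, ∀ x ∈ X K, 0 ≤ q K x)
    (hJS : ∀ K t, |t| ≤ l₀ → ∀ x ∈ X K,
      ∫ y, (∏ j ∈ Finset.range K, e K x j (iterMap (E := fun j => C K j) (avg K) j y)) * ρ₀ K t y ∂ν K 0 ≤ q K x * ∫ y, ρ₀ K t y ∂ν K 0) :
    ExtractionLaws l₀ (HIndex.termSet (skelFam T p₀))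
      (fun _ t => Repr172R.weight (I := skelFam T p₀) (fun K => ν K K) (reprFam T p₀ ρ₀ hρ h0 B hB) t) Bad X Badx q where
  bad_subset := bad_subset
  cover := cover
  q_nonneg K x hx := hq K x hx
  extract K t ht x hx :=
    extract_byValue_of_subset T p₀ ρ₀ hρ h0 B hB ν avg χ S e hp₀ K t x (hread K x hx) (havg K) (hχ K) (hχ0 K) (hmod K) (hunit K)
      (hGdInt K) (he K x hx) (heg K x hx) (hpin K x hx) (hJS K t ht x hx)

/-- **THE KEYED EXTRACTION LAWS FROM JOINT MULTISCALE EXPONENTIAL MOMENTS** (the by-value cost–volume bookkeeping for the END): pin, per (cutoff, key), the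
levels `J K x`; at a pinned level `j < K` after every pattern prefix let the pinned characteristic functions form a sub-partition of unity supported in the
event `{θ K x j ≤ Q K x j}`, and leave the other levels free; then print's Chebyshev letters and ONE joint exponential moment per (cutoff, source value, key)
  (JM) `∫ (Π_{j ∈ J K x, j<K} e^{δ K x j · Q K x j (iterMap (avg K) j y)})·ρ₀ K t y dν_{K,0} ≤ e^{Σ_{j ∈ J K x, j<K} b K x j}·∫ ρ₀ K t dν_{K,0}`
give `ExtractionLaws` with quotients `q K x = exp Σ_{j ∈ J K x, j<K} (b K x j − δ K x j·θ K x j)` — «extracted cost against joint volume», key by key. [folklore] -/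
theorem extractionLaws_byValue_of_jointMoment {l₀ : ℝ} (Bad : ℕ → ℝ → Finset (HIndex.Idx (skelFam T p₀)))
    (X : ℕ → Finset α) (Badx : ℕ → α → Finset (HIndex.Idx (skelFam T p₀))) (J : ℕ → α → Finset ℕ)
    (θ δ b : ℕ → α → ℕ → ℝ) (Q : (K : ℕ) → α → (j : ℕ) → C K j → ℝ) (hδ : ∀ K x j, 0 ≤ δ K x j)
    (hp₀ : ∀ K j g, p₀ K j ∈ (T K).branch j g)
    (bad_subset : ∀ K t, |t| ≤ l₀ → Bad K t ⊆ HIndex.termSet (skelFam T p₀) K)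
    (cover : ∀ K t, |t| ≤ l₀ → ∀ τ ∈ Bad K t, ∃ x ∈ X K, τ ∈ Badx K x)
    (hread : ∀ K, ∀ x ∈ X K, Badx K x ⊆ badx T p₀ S K x)
    (havg : ∀ (K j : ℕ) (m : C K (j + 1) → ℝ), (𝒢 K (j + 1)).Gd m → (𝒢 K j).Gd (fun y => m (avg K j y)))
    (hχ : ∀ K j g p, (𝒢 K j).Gd (χ K j g p)) (hχ0 : ∀ K j g p y, 0 ≤ χ K j g p y)
    (hmod : ∀ (K j : ℕ) (g : Fin j → P) (p : P), g ∈ (T K).adm j → p ∈ (T K).branch j g → ∀ (m : C K (j + 1) → ℝ) (f : C K j → ℝ),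
      (𝒢 K (j + 1)).Gd m → (𝒢 K j).Gd f →
        ∫ x, m x * ((T K).op j g p).T f x ∂ν K (j + 1) = ∫ y, m (avg K j y) * (χ K j g p y * f y) ∂ν K j)
    (hunit : ∀ (K j : ℕ) (g : Fin j → P), g ∈ (T K).adm j → ∀ y, ∑ p ∈ (T K).branch j g, χ K j g p y = 1)
    (hGdInt : ∀ (K j : ℕ) (f : C K j → ℝ), (𝒢 K j).Gd f → Integrable f (ν K j))
    (hQg : ∀ K, ∀ x ∈ X K, ∀ j, (𝒢 K j).Gd fun y => Real.exp (δ K x j * Q K x j y))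
    (hχ1 : ∀ K, ∀ x ∈ X K, ∀ (j : ℕ) (g : Fin j → P), j < K → j ∈ J K x → g ∈ admS (T K) (S K x) j →
      ∀ y, ∑ p ∈ (T K).branch j g ∩ S K x j g, χ K j g p y ≤ 1)
    (hsupp : ∀ K, ∀ x ∈ X K, ∀ (j : ℕ) (g : Fin j → P), j < K → j ∈ J K x → g ∈ admS (T K) (S K x) j →
      ∀ p ∈ (T K).branch j g ∩ S K x j g, ∀ y, χ K j g p y ≠ 0 → θ K x j ≤ Q K x j y)
    (hfree : ∀ K, ∀ x ∈ X K, ∀ (j : ℕ) (g : Fin j → P), j < K → j ∉ J K x → (T K).branch j g ⊆ S K x j g)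
    (hJM : ∀ K t, |t| ≤ l₀ → ∀ x ∈ X K,
      ∫ y, (∏ j ∈ (Finset.range K).filter (· ∈ J K x), Real.exp (δ K x j * Q K x j (iterMap (E := fun j => C K j) (avg K) j y))) *
          ρ₀ K t y ∂ν K 0 ≤ Real.exp (∑ j ∈ (Finset.range K).filter (· ∈ J K x), b K x j) * ∫ y, ρ₀ K t y ∂ν K 0) :
    ExtractionLaws l₀ (HIndex.termSet (skelFam T p₀))
      (fun _ t => Repr172R.weight (I := skelFam T p₀) (fun K => ν K K) (reprFam T p₀ ρ₀ hρ h0 B hB) t) Bad X Badx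
      (fun K x => Real.exp (∑ j ∈ (Finset.range K).filter (· ∈ J K x), (b K x j - δ K x j * θ K x j))) where
  bad_subset := bad_subset
  cover := cover
  q_nonneg K x _ := (Real.exp_pos _).le
  extract K t ht x hx := by
    refine (Finset.sum_le_sum_of_subset_of_nonneg (hread K x hx) fun τ _ _ => weight_reprFam_nonneg T p₀ ρ₀ hρ h0 B hB ν t τ).trans ?_
    rw [sum_badx_weight, sum_termSet_weight_eq_integral_byValue T p₀ ρ₀ hρ h0 B hB ν avg χ hp₀ K t (hχ K) (hmod K) (hunit K) (hGdInt K),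
      ← sum_adm_integral_eterm_eq (T K) (ν K) (avg K) (χ K) (havg K) (hχ K) (hmod K) (hρ K t) (hGdInt K 0) (hunit K) K]
    exact sum_admS_integral_le_of_jointMoment (T K) (ν K) (avg K) (χ K) (S K x) (J K x) (θ K x) (δ K x) (b K x) (Q K x) (hδ K x)
      (havg K) (hχ K) (hχ0 K) (hmod K) (hunit K) (hρ K t) (h0 K t) (hGdInt K 0) (hQg K x hx) K (hχ1 K x hx) (hsupp K x hx)
      (hfree K x hx) (hJM K t ht x hx)

end Laws

end Summit.QuantumFields.YangMills.BalabanUVNodes.N20ByValueLaws
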